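import Literature.NumberTheory.CubicFields.PsiFourierNormalForm
import HarnessLib

/-!
# The Fourier transform of `Ψ_{p²} = 𝟙_{p² ∣ Disc}`, II: an arbitrary primitive dual vector
(Bhargava–Taniguchi–Thorne 2023, Prop. 5.2, the cases "Divisible by `p⁴`, `p³`, `p²`" and "otherwise", `p ≥ 5`)

Topic `Literature/NumberTheory/CubicFields`; continues `PsiFourierNormalForm.lean` (the fibre-sum formula
`p⁸ Ψ̂_{p²}(ι⁻¹ f) = Σ_{y₀} e(⟨f, ỹ₀⟩/p²) Z_f(y₀)`, the hyperplane lemma, and the evaluation in the normal form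
`p ∣ a, b, c`, `p ∤ d`), using `SingularZeroTransport.lean` (a nonzero form over `𝔽_p` with `Disc = 0` has
a singular zero, moved to `(1 : 0)` by `SL₂(ℤ)`) and `ShintaniDualDensity.lean` (`GL₂(ℤ)`-equivariance of
Shintani's pairing and invariance of `Φ̂`). Everything here is PROVED (no definitions, no named facts):

* `BinaryCubic.dot_grad_subst` — gradient covariance `⟨∇Disc(y∘γ), δ∘γ⟩ = (det γ)⁶ ⟨∇Disc(y), δ⟩`;
* `fourierDual_psiLocal_twist` — `Ψ̂_{p²}` is `GL₂(ℤ)`-invariant on the dual lattice;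
* **`exists_normalForm_of_fourierDual_ne_zero`** — for `f` in the dual lattice, primitive at `p`, with
  `Ψ̂_{p²}(ι⁻¹ f) ≠ 0`, some `γ ∈ SL₂(ℤ)` brings `f` to the normal form `p ∣ a, b, c`, `p ∤ d` (a nonzero fibre
  sum forces `ι⁻¹ f mod p` to annihilate `ker ∇Disc(y₀)` at a smooth point `y₀` of `{Disc = 0}`; transporting
  the singular zero of `y₀` to `(1:0)` gives `∇Disc = (−4c³, 0, 0, 0)` there, i.e. `f ≡ μ v³`);
* **`norm_fourierDual_psiLocal_le_of_not_isMultiple`** — hence `|Ψ̂_{p²}(ι⁻¹ f)| ≤ p⁻³` for every primitive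
  dual `f`, and **`fourierDual_psiLocal_of_ne_zero`** — if `Ψ̂_{p²}(ι⁻¹ f) ≠ 0` then `f ∉ U_p` (nonmaximal
  at `p`), `p³ ∣ Disc f`, and the transform is `p⁻³ − p⁻⁴` (`p⁴ ∣ Disc f`) or `−p⁻⁴` (`p³ ∥ Disc f`) — BTT
  Prop. 5.2 for the second definition of `Ψ_{p²}` and `p ∤ f`: "Divisible by `p⁴`: `O(p⁻³)`", "Divisible by
  `p³`: `O(p⁻⁴)`", "Divisible by `p²`: `O(p⁻⁵)`" (indeed `0`), "Otherwise `0`".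

## References

* M. Bhargava, T. Taniguchi, F. Thorne, *Improved error estimates for the Davenport–Heilbronn theorems*,
  Math. Ann. 389 (2024) = arXiv:2107.12819, §5, Prop. 5.2 [BhargavaTaniguchiThorne2023].
* T. Taniguchi, F. Thorne, *Secondary terms in counting functions for cubic fields*, Duke Math. J. 162
  (2013), Lemmas 3.3, 4.3 [TaniguchiThorne2013].
-/

noncomputable section

open Complex Finset
open Literature.NumberTheory.CubicFields.BinaryCubic

namespace Literature.NumberTheory.CubicFields

/-! ## Part II — an arbitrary primitive `f`: vanishing off the cube type, transport to the normal form -/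

/-- **Gradient covariance**: `⟨∇Disc(y ∘ γ), δ ∘ γ⟩ = (det γ)⁶ ⟨∇Disc(y), δ⟩` (differentiate
`Disc(f ∘ γ) = (det γ)⁶ Disc f` along `δ`). [folklore] -/
theorem BinaryCubic.dot_grad_subst {R : Type*} [CommRing R] (y δ : BinaryCubic R) (γ : Matrix (Fin 2) (Fin 2) R) :
    dot (grad (y.subst γ)) (δ.subst γ) = γ.det ^ 6 * dot (grad y) δ := by
  simp only [dot, grad, discDa, discDb, discDc, discDd, BinaryCubic.subst, Matrix.det_fin_two]
  ring

section Primitive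

variable {p : ℕ} [hp : Fact p.Prime]

omit hp in
/-- `Ψ_{p²}` is `GL₂(ℤ/p²ℤ)`-invariant (`Disc(γ·y) = (det γ)¹⁰ Disc y`). [folklore] -/
theorem psiLocal_twist (γ' : Matrix (Fin 2) (Fin 2) (ZMod (p ^ 2))) (hγ' : IsUnit γ'.det) (y : BinaryCubic (ZMod (p ^ 2))) :
    psiLocal p (twist γ' y) = psiLocal p y := by
  unfold psiLocal
  rw [disc_twist]
  simp only [(hγ'.pow 10).mul_right_eq_zero]

/-- **`Ψ̂_{p²}` is `GL₂(ℤ)`-invariant on the dual lattice.** [folklore] -/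
theorem fourierDual_psiLocal_twist {γ : Matrix (Fin 2) (Fin 2) ℤ} (hγ : IsUnit γ.det) {f : BinaryCubic ℤ}
    (hf : IsDualForm f) : fourierDual (psiLocal p) (twist γ f) = fourierDual (psiLocal p) f :=
  fourierDual_twist (fun γ' hγ' y => psiLocal_twist γ' hγ' y) hγ hf

/-- **Equivariance of the dual vector**: `⟨ι⁻¹(γ·f), v ∘ γ̄⟩ = ⟨ι⁻¹ f, v⟩` for `det γ = 1` (Shintani's
pairing is invariant). [folklore] -/
theorem dot_dualVec_twist {f : BinaryCubic ℤ} (hf : IsDualForm f) {γ : Matrix (Fin 2) (Fin 2) ℤ} (hdet : γ.det = 1)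
    (v : BinaryCubic (ZMod p)) :
    dot (dualVec p (twist γ f)) (v.subst (γ.map (Int.castRingHom (ZMod p)))) = dot (dualVec p f) v := by
  have hdetp : (γ.map (Int.castRingHom (ZMod p))).det = 1 := by
    rw [← RingHom.mapMatrix_apply, ← RingHom.map_det, hdet, map_one]
  have h := dualPairing_twist hf γ v
  have ht : twist (γ.map (Int.castRingHom (ZMod p))) v = v.subst (γ.map (Int.castRingHom (ZMod p))) := by
    rw [twist, hdetp, one_smul]
  rw [hdet, one_pow, Int.cast_one, one_mul, ht] at h
  rw [← dualPairing_eq_dot, ← dualPairing_eq_dot, h]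

/-- **Transport to the normal form.** Let `p ≥ 5`, `f` in the dual lattice and primitive at `p`. If
`Ψ̂_{p²}(ι⁻¹ f) ≠ 0` then some `γ ∈ SL₂(ℤ)` brings `f` to the normal form `p ∣ a, b, c`, `p ∤ d` — i.e.
`f mod p` is a nonzero multiple of the cube of a linear form. (A nonzero fibre sum forces the dual vector to
be proportional to `∇Disc(y₀)` at a smooth point `y₀` of `Disc = 0` over `𝔽_p`; the singular zero of `y₀`
is moved to `(1 : 0)` by `SL₂(ℤ)` (`exists_sl2z_row_eq`), where `∇Disc = (−4c³, 0, 0, 0)`.) [folklore] -/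
theorem exists_normalForm_of_fourierDual_ne_zero (hp5 : 5 ≤ p) {f : BinaryCubic ℤ} (hf : IsDualForm f)
    (hprim : ¬ f.IsMultiple p) (hne : fourierDual (psiLocal p) f ≠ 0) :
    ∃ γ : Matrix (Fin 2) (Fin 2) ℤ, γ.det = 1 ∧ (p : ℤ) ∣ (twist γ f).a ∧ (p : ℤ) ∣ (twist γ f).b ∧
      (p : ℤ) ∣ (twist γ f).c ∧ ¬ (p : ℤ) ∣ (twist γ f).d := by
  have _h5 := hp5
  -- a `y₀` with nonzero fibre sum
  rw [fourierDual_psiLocal_eq] at hne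
  obtain ⟨y₀, -, hy₀⟩ := Finset.exists_ne_zero_of_sum_ne_zero (right_ne_zero_of_mul hne)
  have hfs : fibreSum f y₀ ≠ 0 := right_ne_zero_of_mul hy₀
  unfold fibreSum at hfs
  by_cases h0 : y₀.disc = 0
  swap
  · rw [if_neg h0] at hfs; exact absurd rfl hfs
  rw [if_pos h0] at hfs
  set w := dualVec p f with hw
  set L := grad y₀ with hL
  have ortho : ∀ v, dot L v = 0 → dot w v = 0 := fun v hv => by
    by_contra hwv; exact hfs (hyperSum_eq_zero_of_shift _ hv hwv)
  -- `w ≠ 0` (primitivity)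
  have hw0 : ¬ (w.a = 0 ∧ w.b = 0 ∧ w.c = 0 ∧ w.d = 0) := by
    rintro ⟨h1, h2, h3, h4⟩
    apply hprim
    simp only [hw, dualVec, neg_eq_zero, ZMod.intCast_zmod_eq_zero_iff_dvd] at h1 h2 h3 h4
    refine ⟨h4, ?_, ?_, h1⟩
    · rw [← Int.mul_ediv_cancel' hf.1]; exact dvd_mul_of_dvd_right h3 _
    · rw [← Int.mul_ediv_cancel' hf.2]; exact dvd_mul_of_dvd_right h2 _
  -- `L ≠ 0`, hence `y₀ ≠ 0`
  have hL0 : ¬ (L.a = 0 ∧ L.b = 0 ∧ L.c = 0 ∧ L.d = 0) := by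
    rintro ⟨h1, h2, h3, h4⟩
    apply hw0
    refine ⟨?_, ?_, ?_, ?_⟩
    · simpa [dot] using ortho ⟨1, 0, 0, 0⟩ (by simp [dot, h1, h2, h3, h4])
    · simpa [dot] using ortho ⟨0, 1, 0, 0⟩ (by simp [dot, h1, h2, h3, h4])
    · simpa [dot] using ortho ⟨0, 0, 1, 0⟩ (by simp [dot, h1, h2, h3, h4])
    · simpa [dot] using ortho ⟨0, 0, 0, 1⟩ (by simp [dot, h1, h2, h3, h4])
  have hy00 : ¬ (y₀.a = 0 ∧ y₀.b = 0 ∧ y₀.c = 0 ∧ y₀.d = 0) := by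
    rintro ⟨h1, h2, h3, h4⟩
    apply hL0
    simp [hL, grad, discDa, discDb, discDc, discDd, h1, h2, h3, h4]
  -- transport the singular zero of `y₀` to `(1, 0)`
  obtain ⟨v₀, hv₀, hv₀0⟩ := exists_mem_singSet_ne_zero hp.out hy00 h0
  have hrs : ¬ (v₀.1 = 0 ∧ v₀.2 = 0) := fun h => hv₀0 (Prod.ext h.1 h.2)
  obtain ⟨γ, hdet, hr, hs⟩ := exists_sl2z_row_eq hp.out hrs
  set γp : Matrix (Fin 2) (Fin 2) (ZMod p) := γ.map (Int.castRingHom (ZMod p)) with hγp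
  have hdetp : γp.det = 1 := by rw [hγp, ← RingHom.mapMatrix_apply, ← RingHom.map_det, hdet, map_one]
  have hγpu : IsUnit γp.det := by rw [hdetp]; exact isUnit_one
  set y₁ := y₀.subst γp with hy₁
  have hsing : ((1 : ZMod p), (0 : ZMod p)) ∈ y₁.singSet := by
    refine mem_singSet_subst y₀ ?_
    have : rowMul ((1 : ZMod p), 0) γp = v₀ := by
      refine Prod.ext ?_ ?_ <;> simp [rowMul, hγp, Matrix.map_apply, hr, hs]
    rw [this]; exact hv₀
  obtain ⟨hy₁a, hy₁b⟩ := (one_zero_mem_singSet y₁).mp hsing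
  -- transported orthogonality
  set f₁ := twist γ f with hf₁
  set w₁ := dualVec p f₁ with hw₁
  set L₁ := grad y₁ with hL₁def
  have ortho₁ : ∀ v', dot L₁ v' = 0 → dot w₁ v' = 0 := by
    intro v' hv'
    set v := v'.subst γp⁻¹
    have hvv : v' = v.subst γp := (subst_inv_subst v' hγpu).symm
    have e1 : dot L₁ v' = dot L v := by rw [hvv, hL₁def, hy₁, dot_grad_subst, hdetp, one_pow, one_mul]
    have e2 : dot w₁ v' = dot w v := by rw [hvv, hw₁, hf₁]; exact dot_dualVec_twist hf hdet v
    rw [e2]; exact ortho v (e1.symm.trans hv')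
  -- `L₁ = (−4 c₁³, 0, 0, 0)` with `c₁ ≠ 0`
  have hy₁eq : y₁ = ⟨0, 0, y₁.c, y₁.d⟩ := BinaryCubic.ext hy₁a hy₁b rfl rfl
  have hL₁ : L₁ = ⟨-4 * y₁.c ^ 3, 0, 0, 0⟩ := by
    rw [hL₁def, hy₁eq]; ext <;> simp [grad, discDa, discDb, discDc, discDd]
  have hw₁b : w₁.b = 0 := by simpa [dot] using ortho₁ ⟨0, 1, 0, 0⟩ (by simp [hL₁, dot])
  have hw₁c : w₁.c = 0 := by simpa [dot] using ortho₁ ⟨0, 0, 1, 0⟩ (by simp [hL₁, dot])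
  have hw₁d : w₁.d = 0 := by simpa [dot] using ortho₁ ⟨0, 0, 0, 1⟩ (by simp [hL₁, dot])
  have hw₁a : w₁.a ≠ 0 := by
    intro hw₁a
    apply hw0
    have hzero : ∀ v, dot w v = 0 := fun v => by
      rw [← dot_dualVec_twist hf hdet v]
      show dot w₁ (v.subst γp) = 0
      simp only [dot, hw₁a, hw₁b, hw₁c, hw₁d, zero_mul, add_zero]
    refine ⟨?_, ?_, ?_, ?_⟩
    · simpa [dot] using hzero ⟨1, 0, 0, 0⟩
    · simpa [dot] using hzero ⟨0, 1, 0, 0⟩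
    · simpa [dot] using hzero ⟨0, 0, 1, 0⟩
    · simpa [dot] using hzero ⟨0, 0, 0, 1⟩
  -- translate into divisibilities of the coefficients of `f₁ = γ · f`
  have hf₁dual : IsDualForm f₁ := hf.twist γ
  have ea : w₁.d = -((f₁.a : ℤ) : ZMod p) := rfl
  have eb : w₁.c = ((f₁.b / 3 : ℤ) : ZMod p) := rfl
  have ec : w₁.b = -((f₁.c / 3 : ℤ) : ZMod p) := rfl
  have ed : w₁.a = ((f₁.d : ℤ) : ZMod p) := rfl
  refine ⟨γ, hdet, ?_, ?_, ?_, ?_⟩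
  · rw [ea, neg_eq_zero, ZMod.intCast_zmod_eq_zero_iff_dvd] at hw₁d; exact hw₁d
  · rw [eb, ZMod.intCast_zmod_eq_zero_iff_dvd] at hw₁c
    rw [← Int.mul_ediv_cancel' hf₁dual.1]; exact dvd_mul_of_dvd_right hw₁c _
  · rw [ec, neg_eq_zero, ZMod.intCast_zmod_eq_zero_iff_dvd] at hw₁b
    rw [← Int.mul_ediv_cancel' hf₁dual.2]; exact dvd_mul_of_dvd_right hw₁b _
  · intro hd
    exact hw₁a (by rw [ed, ZMod.intCast_zmod_eq_zero_iff_dvd]; exact hd)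

/-- **`|Ψ̂_{p²}(ι⁻¹ f)| ≤ p⁻³` for every `f` in the dual lattice primitive at `p`** (`p ≥ 5`): the
"Divisible by `p⁴`, `p³`, `p²`" and "otherwise" cases of BTT Prop. 5.2 at once. [cite: BhargavaTaniguchiThorne2023, Prop. 5.2] -/
theorem norm_fourierDual_psiLocal_le_of_not_isMultiple (hp5 : 5 ≤ p) {f : BinaryCubic ℤ} (hf : IsDualForm f)
    (hprim : ¬ f.IsMultiple p) : ‖fourierDual (psiLocal p) f‖ ≤ ((p : ℝ) ^ 3)⁻¹ := by
  have hp1 : (1 : ℝ) ≤ p := by exact_mod_cast hp.out.one_lt.le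
  have hp0 : (0 : ℝ) < p := by positivity
  have h34 : ((p : ℝ) ^ 4)⁻¹ ≤ ((p : ℝ) ^ 3)⁻¹ :=
    inv_anti₀ (by positivity) (pow_le_pow_right₀ hp1 (by norm_num))
  have h4 : 0 < ((p : ℝ) ^ 4)⁻¹ := by positivity
  by_cases hne : fourierDual (psiLocal p) f = 0
  · rw [hne, norm_zero]; positivity
  obtain ⟨γ, hdet, ha, hb, hc, hd⟩ := exists_normalForm_of_fourierDual_ne_zero hp5 hf hprim hne
  have hγu : IsUnit γ.det := by rw [hdet]; exact isUnit_one
  rw [← fourierDual_psiLocal_twist hγu hf,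
    fourierDual_psiLocal_normalForm hp5 (hf.twist γ).1 (hf.twist γ).2 ha hb hc hd]
  split_ifs
  · rw [show ((p : ℂ) ^ 3)⁻¹ - ((p : ℂ) ^ 4)⁻¹ = (((((p : ℝ) ^ 3)⁻¹ - ((p : ℝ) ^ 4)⁻¹ : ℝ)) : ℂ) by push_cast; ring,
      Complex.norm_real, Real.norm_eq_abs, abs_of_nonneg (by linarith)]
    linarith
  · rw [norm_neg, show ((p : ℂ) ^ 4)⁻¹ = ((((p : ℝ) ^ 4)⁻¹ : ℝ) : ℂ) by push_cast; ring, Complex.norm_real,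
      Real.norm_eq_abs, abs_of_nonneg h4.le]
    exact h34
  · rw [norm_zero]; positivity

omit hp in
/-- `Disc` of a form with `p² ∣ a`, `p ∣ b`, `p ∣ c`: `p³ ∣ Disc`, and `p⁴ ∣ Disc ⟺ p ∣ 4 (b/p)³ d`. [folklore] -/
theorem disc_of_sq_dvd_a {g : BinaryCubic ℤ} {a'' b' c' : ℤ} (ha : g.a = p ^ 2 * a'') (hb : g.b = p * b') (hc : g.c = p * c') :
    g.disc = (p : ℤ) ^ 3 * (-4 * b' ^ 3 * g.d + p * (b' ^ 2 * c' ^ 2 - 4 * p * a'' * c' ^ 3 - 27 * a'' ^ 2 * g.d ^ 2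
      + 18 * a'' * b' * c' * g.d)) := by
  rw [disc_eq, ha, hb, hc]; ring

/-- **When `Ψ̂_{p²}(ι⁻¹ f) ≠ 0`** (`f` dual, primitive at `p`, `p ≥ 5`): `f ∉ U_p` (the ring of `f` is
nonmaximal at `p`), `p³ ∣ Disc f`, and `Ψ̂_{p²}(ι⁻¹ f) = p⁻³ − p⁻⁴` if `p⁴ ∣ Disc f`, `= −p⁻⁴` if `p³ ∥ Disc f`
(BTT Prop. 5.2: the cases "Divisible by `p⁴`" and "Divisible by `p³`"; "Divisible by `p²`" and "otherwise"
give `0`). [cite: BhargavaTaniguchiThorne2023, Prop. 5.2] -/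
theorem fourierDual_psiLocal_of_ne_zero (hp5 : 5 ≤ p) {f : BinaryCubic ℤ} (hf : IsDualForm f)
    (hprim : ¬ f.IsMultiple p) (hne : fourierDual (psiLocal p) f ≠ 0) :
    ¬ f.MemU p ∧ (p : ℤ) ^ 3 ∣ f.disc ∧
      fourierDual (psiLocal p) f =
        (if (p : ℤ) ^ 4 ∣ f.disc then ((p : ℂ) ^ 3)⁻¹ - ((p : ℂ) ^ 4)⁻¹ else -((p : ℂ) ^ 4)⁻¹) := by
  have hp0 : (p : ℤ) ≠ 0 := Nat.cast_ne_zero.mpr hp.out.ne_zero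
  have hpr : Prime (p : ℤ) := Nat.prime_iff_prime_int.mp hp.out
  obtain ⟨γ, hdet, ha, hb, hc, hd⟩ := exists_normalForm_of_fourierDual_ne_zero hp5 hf hprim hne
  have hγu : IsUnit γ.det := by rw [hdet]; exact isUnit_one
  set g := twist γ f with hg
  have hgdual : IsDualForm g := hf.twist γ
  have hFT : fourierDual (psiLocal p) f = fourierDual (psiLocal p) g := (fourierDual_psiLocal_twist hγu hf).symm
  have hformula := fourierDual_psiLocal_normalForm hp5 hgdual.1 hgdual.2 ha hb hc hd
  -- `p² ∣ g.a` since the transform is nonzero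
  have ha2 : (p : ℤ) ^ 2 ∣ g.a := by
    by_contra h2
    rw [if_neg h2] at hformula
    exact hne (hFT.trans hformula)
  obtain ⟨a'', ha''⟩ := ha2
  obtain ⟨b', hb'⟩ := hb
  obtain ⟨c', hc'⟩ := hc
  have hdisc : f.disc = g.disc := (disc_twist_of_isUnit hγu f).symm
  have hdg := disc_of_sq_dvd_a (p := p) ha'' hb' hc'
  -- `p⁴ ∣ Disc ⟺ p ∣ b' ⟺ p² ∣ g.b`
  have h4iff : (p : ℤ) ^ 4 ∣ g.disc ↔ (p : ℤ) ^ 2 ∣ g.b := by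
    have eR : (p : ℤ) ^ 2 ∣ g.b ↔ (p : ℤ) ∣ b' := by rw [hb', sq, mul_dvd_mul_iff_left hp0]
    have eL : (p : ℤ) ^ 4 ∣ g.disc ↔ (p : ℤ) ∣ -4 * b' ^ 3 * g.d := by
      rw [hdg, show ((p : ℤ)) ^ 4 = (p : ℤ) ^ 3 * p by ring, mul_dvd_mul_iff_left (pow_ne_zero 3 hp0),
        dvd_add_left (dvd_mul_right _ _)]
    rw [eL, eR]
    constructor
    · intro h
      rcases hpr.dvd_or_dvd h with h1 | h1
      · rcases hpr.dvd_or_dvd h1 with h2 | h2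
        · exfalso
          have := Int.le_of_dvd (by norm_num) (dvd_neg.mp h2)
          omega
        · exact hpr.dvd_of_dvd_pow h2
      · exact absurd h1 hd
    · intro h
      exact dvd_mul_of_dvd_left (dvd_mul_of_dvd_right (dvd_pow h three_ne_zero) _) _
  refine ⟨?_, ?_, ?_⟩
  · -- `f ∉ U_p`: `g ∼ f` has `p² ∣ a`, `p ∣ b`
    intro hU
    exact hU.2 ⟨g, ⟨γ, hγu, rfl⟩, ⟨a'', ha''⟩, ⟨b', hb'⟩⟩
  · rw [hdisc, hdg]; exact dvd_mul_right _ _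
  · rw [hFT, hformula, if_pos ⟨a'', ha''⟩, hdisc]
    by_cases h4 : (p : ℤ) ^ 4 ∣ g.disc
    · rw [if_pos h4, if_pos (h4iff.mp h4)]
    · rw [if_neg h4, if_neg (fun h => h4 (h4iff.mpr h))]

end Primitive

end Literature.NumberTheory.CubicFields

end
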